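import Mathlib.Algebra.Order.Field.Basic
import Mathlib.Algebra.Order.Ring.Rat
import Mathlib.Tactic.Linarith
import Mathlib.Tactic.NormNum
import Mathlib.Tactic.Ring
import Summits.Ventures.CertifiedManyBodySolver.Downfold.PhaseMapMaterialVerdict

/-!
# The T_c-BAND metrics of the material-oracle acceptance test (ACCEPTANCE §4.4, LEVEL 3): the v1.3
# INFORMATIVENESS classes, the CREDIT rule, and the FALSE / STRADDLE / OK statuses of a band on a
# measured-normal column — as total functions, with their property sheet PROVED

Venture CertifiedManyBodySolver, cell `pub/hubbard-downfold`, seat hubbard-downfold-score-1 (second scoring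
engine); namespace `Summit.Ventures.CertifiedManyBodySolver.Downfold.CellScore` (continues
`PhaseMapCellScore.lean` — `inside`, `w3Cell`, `outcome`, `truthNoSC` — and `PhaseMapMaterialVerdict.lean` —
`verdict`, `kind`). D-0099 verbatim: «scored against known (T, P, x) phase diagrams». Everything is PROVED
(linear arithmetic over `ℚ`).

WHAT THIS IS NOT: not a statement about any material and not the scorer of record (`deputy-2/score.py` v1.3
bb325366 and `validation/score/phasemap.py` 1.3.1 are; both implement §4.4 with the same `band_info` function
and agree on every class / credit / straddle flag of 86 400 synthetic maps, kit j258740). This is the KERNEL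
REFERENCE for those functions and makes four prose sentences of the acceptance text theorems.

* §1 INFORMATIVENESS (§4.4 v1.3 verbatim: r = relative half-width (hi − lo)/(hi + lo), w = hi/lo = (1+r)/(1−r);
  `informative` r ≤ 0.25 (w ≤ 5/3) · `moderate` 0.25 < r ≤ 0.50 (w ≤ 3) · `wide` 0.50 < r ≤ 0.60 (3 < w ≤ 4)
  · `uninformative` w > 4 AND hi − lo > 10 K · `wide(span≤10K)` w > 4 but hi − lo ≤ 10 K): `relHalfWidth`,
  `infoClass`; the CREDIT RULE «INSIDE ∧ class ≠ uninformative»: `credit`. THEOREMS: the three «(w ≤ …)»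
  parentheses of the text are exact (`relHalfWidth_le_quarter_iff` etc.: for 0 < lo ≤ hi, r ≤ 1/4 ⇔ 3hi ≤ 5lo,
  r ≤ 1/2 ⇔ hi ≤ 3lo, r ≤ 3/5 ⇔ hi ≤ 4lo); `infoClass_eq_uninformative_iff` (0 ≤ lo ≤ hi: uninformative ⇔
  4·lo < hi ∧ 10 < hi − lo — the engines' two-Boolean test); CREDIT: `inside_of_credit`, no credit for an
  uninformative band, credit for every inside band with span ≤ 10 K or w ≤ 4; THE SAYS-NOTHING THEOREM
  (`inside_zero_lo`, `credit_zero_lo_eq_false`): «a [0, 300] K band «hits» everything and says nothing» — a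
  band [0, B] is INSIDE for every measured T_c ≤ B + τ and, once B > 10 K, is uninformative, so it never earns
  credit; `relHalfWidth_smul`: r is scale-free while the class is not (the 10 K guard is an absolute physics
  scale: [2, 9] K is `wide(span≤10K)`, credited — Al-type weak coupling; [20, 90] K, same r, is uninformative).
* §2 MEASURED-NORMAL COLUMNS (§4.4 verbatim: «FALSE-BAND if lo > T_min_measured (oracle predicts SC where none
  is seen); OK if hi < T_min_measured or band null»; v1.3 «STRADDLE BAND … lo ≤ T_min_measured ≤ hi (and hi ≥
  0.1 K) … its material verdict can never be NOT … UNDETERMINED (ABSTAIN …) or, with lo ≥ 0.1 K / an SC cell,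
  FP»): `falseBand`, `straddleBand`. THEOREMS: exclusivity and trichotomy for an asserting band;
  `verdict_ne_NOT_of_straddle` + `kind_of_straddle` (ABSTAIN or FP, never TN/FN — the v1.3 sentence);
  `verdict_eq_SC_of_falseBand` (+ `kind` = FP on a non-superconductor); LEVEL-2 CONTRAST: a false band FORCES
  cell disagreements on [T_min, lo) (`PhaseMapCellScore.disagree_or_undetermined_of_falseBand`) while a straddle
  band forces NONE (`straddle_allows_agreeing_not`: W3 permits an agreeing «not» at every T ≥ T_min) — the
  straddle is visible only at level 4, which is why v1.3 prints it.
* §3 the BECAUSE-line numbers of §4.4 evaluated by the kernel: H₃S [120, 290] K moderate (credited), [50, 290] K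
  uninformative (denied), MgB₂'s boxed [13, 79] K uninformative, an Al-type [0.5, 2.3] K `wide(span≤10K)`
  (credited); Cu straddle [0, 5] K (score.py selftest S6): ABSTAIN.

Design: `ℚ`, Booleans as the scorers print them; `relHalfWidth` carries the engines' guard (0 when hi + lo ≤ 0).
NOT here: MISS distance, medians, per-branch bookkeeping (reporting only), the e–ph 0.80 threshold itself.
-/

namespace Summit.Ventures.CertifiedManyBodySolver.Downfold

namespace CellScore

/-! ## §1 Informativeness classes and the credit rule (ACCEPTANCE §4.4 v1.3) -/

/-- The five informativeness classes of a T_c band (§4.4 v1.3). [folklore] -/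
inductive InfoClass
  /-- r ≤ 0.25 (w ≤ 5/3) -/
  | informative
  /-- 0.25 < r ≤ 0.50 (w ≤ 3) -/
  | moderate
  /-- 0.50 < r ≤ 0.60 (3 < w ≤ 4) -/
  | wide
  /-- w > 4 and hi − lo > 10 K: printed INSIDE, credited nothing -/
  | uninformative
  /-- w > 4 but hi − lo ≤ 10 K (weak-coupling μ* arithmetic): credited -/
  | wideShortSpan
  deriving DecidableEq, Repr

/-- relative half-width `r = (hi − lo)/(hi + lo)` of a band, with the engines' guard `r = 0` when `hi + lo ≤ 0`.
[folklore] -/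
def relHalfWidth (lo hi : ℚ) : ℚ := if 0 < hi + lo then (hi - lo) / (hi + lo) else 0

/-- ACCEPTANCE §4.4 v1.3 informativeness class of a band (both engines' `band_info`). [folklore] -/
def infoClass (lo hi : ℚ) : InfoClass :=
  if relHalfWidth lo hi ≤ 1 / 4 then .informative
  else if relHalfWidth lo hi ≤ 1 / 2 then .moderate
  else if relHalfWidth lo hi ≤ 3 / 5 then .wide
  else if 10 < hi - lo then .uninformative else .wideShortSpan

/-- ACCEPTANCE §4.4 v1.3 CREDIT RULE: a column earns inside credit toward the §7 clause iff INSIDE ∧ class ≠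
`uninformative`. [folklore] -/
def credit (lo hi Tc τ : ℚ) : Bool := inside lo hi Tc τ && decide (infoClass lo hi ≠ .uninformative)

/-- constructor disequalities fed to `norm_num` below (closed terms; `decide`). [folklore] -/
theorem InfoClass.informative_ne_uninformative : InfoClass.informative ≠ .uninformative := by decide
/-- see `InfoClass.informative_ne_uninformative`. [folklore] -/
theorem InfoClass.moderate_ne_uninformative : InfoClass.moderate ≠ .uninformative := by decide
/-- see `InfoClass.informative_ne_uninformative`. [folklore] -/
theorem InfoClass.wide_ne_uninformative : InfoClass.wide ≠ .uninformative := by decide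
/-- see `InfoClass.informative_ne_uninformative`. [folklore] -/
theorem InfoClass.wideShortSpan_ne_uninformative : InfoClass.wideShortSpan ≠ .uninformative := by decide

section info

variable {lo hi : ℚ}

/-- On a positive band the guard is off: `r = (hi − lo)/(hi + lo)`. [folklore] -/
theorem relHalfWidth_of_pos (h : 0 < hi + lo) : relHalfWidth lo hi = (hi - lo) / (hi + lo) := by
  simp [relHalfWidth, h]

/-- `r ≤ c` on a positive band, cleared of the division. [folklore] -/
theorem relHalfWidth_le_iff (h : 0 < hi + lo) (c : ℚ) : relHalfWidth lo hi ≤ c ↔ hi - lo ≤ c * (hi + lo) := by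
  rw [relHalfWidth_of_pos h, div_le_iff₀ h]

/-- «`informative` r ≤ 0.25 (w ≤ 5/3)» is exact: for `0 < lo`, r ≤ 1/4 ⇔ 3·hi ≤ 5·lo. [folklore] -/
theorem relHalfWidth_le_quarter_iff (hlo : 0 < lo) (hle : lo ≤ hi) :
    relHalfWidth lo hi ≤ 1 / 4 ↔ 3 * hi ≤ 5 * lo := by
  rw [relHalfWidth_le_iff (by linarith)]
  constructor <;> intro h <;> linarith

/-- «`moderate` r ≤ 0.50 (w ≤ 3)» is exact: r ≤ 1/2 ⇔ hi ≤ 3·lo. [folklore] -/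
theorem relHalfWidth_le_half_iff (hlo : 0 < lo) (hle : lo ≤ hi) : relHalfWidth lo hi ≤ 1 / 2 ↔ hi ≤ 3 * lo := by
  rw [relHalfWidth_le_iff (by linarith)]
  constructor <;> intro h <;> linarith

/-- «`wide` r ≤ 0.60 (w ≤ 4)» is exact: r ≤ 3/5 ⇔ hi ≤ 4·lo. [folklore] -/
theorem relHalfWidth_le_three_fifths_iff (hlo : 0 < lo) (hle : lo ≤ hi) :
    relHalfWidth lo hi ≤ 3 / 5 ↔ hi ≤ 4 * lo := by
  rw [relHalfWidth_le_iff (by linarith)]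
  constructor <;> intro h <;> linarith

/-- r is SCALE-FREE: a common positive rescaling of both edges leaves it unchanged. [folklore] -/
theorem relHalfWidth_smul {c : ℚ} (hc : 0 < c) (lo hi : ℚ) : relHalfWidth (c * lo) (c * hi) = relHalfWidth lo hi := by
  unfold relHalfWidth
  by_cases h : 0 < hi + lo
  · have h' : 0 < c * hi + c * lo := by nlinarith
    rw [if_pos h', if_pos h, ← mul_sub, ← mul_add, mul_div_mul_left _ _ hc.ne']
  · have h' : ¬ 0 < c * hi + c * lo := by
      intro h''
      apply h
      nlinarith
    rw [if_neg h', if_neg h]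

/-- THE ENGINES' TWO-BOOLEAN TEST is the class: on a well-formed non-negative band, `uninformative` ⇔ hi > 4·lo
∧ hi − lo > 10 K (the degenerate lo = 0 edge included: r = 1 there, or the empty band). [folklore] -/
theorem infoClass_eq_uninformative_iff (hlo : 0 ≤ lo) (hle : lo ≤ hi) :
    infoClass lo hi = .uninformative ↔ 4 * lo < hi ∧ 10 < hi - lo := by
  -- the third cut «r ≤ 3/5 ⇔ hi ≤ 4·lo» also holds at the degenerate edge lo = 0 (r = 1, or the empty band)
  have hw : relHalfWidth lo hi ≤ 3 / 5 ↔ hi ≤ 4 * lo := by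
    rcases eq_or_lt_of_le hlo with rfl | hpos
    · rcases eq_or_lt_of_le hle with rfl | hhi
      · norm_num [relHalfWidth]
      · rw [relHalfWidth_of_pos (by linarith), sub_zero, add_zero, div_self hhi.ne']
        constructor <;> intro h <;> linarith
    · exact relHalfWidth_le_three_fifths_iff hpos hle
  unfold infoClass
  split_ifs with h1 h2 h3 h4
  · simp only [false_iff, not_and]
    intro h
    linarith [hw.mp (h1.trans (by norm_num))]
  · simp only [false_iff, not_and]
    intro h
    linarith [hw.mp (h2.trans (by norm_num))]
  · simp only [false_iff, not_and]
    intro h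
    linarith [hw.mp h3]
  · simp only [true_iff]
    exact ⟨lt_of_not_ge (fun h => h3 (hw.mpr h)), h4⟩
  · simp only [false_iff, not_and]
    exact fun _ => h4

/-- A band of span ≤ 10 K is never `uninformative` (the 10 K guard of the weak-coupling regime). [folklore] -/
theorem infoClass_ne_uninformative_of_span_le (h : hi - lo ≤ 10) : infoClass lo hi ≠ .uninformative := by
  unfold infoClass
  split_ifs with h1 h2 h3 h4
  · simp
  · simp
  · simp
  · exact absurd h4 (not_lt.mpr h)
  · simp

/-- A band with w ≤ 4 (hi ≤ 4·lo) is never `uninformative`. [folklore] -/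
theorem infoClass_ne_uninformative_of_le_four_mul (h : hi ≤ 4 * lo) : infoClass lo hi ≠ .uninformative := by
  have h3 : relHalfWidth lo hi ≤ 3 / 5 := by   -- no `lo ≤ hi` needed: an inverted band has r ≤ 0
    unfold relHalfWidth
    split_ifs with hp
    · rw [div_le_iff₀ hp]
      linarith
    · norm_num
  unfold infoClass
  split_ifs <;> simp_all

end info

section creditRule

variable {lo hi Tc τ : ℚ}

/-- `credit` unfolded. [folklore] -/
theorem credit_eq_true_iff : credit lo hi Tc τ = true ↔ inside lo hi Tc τ = true ∧ infoClass lo hi ≠ .uninformative := by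
  simp [credit]

/-- Credit implies INSIDE (the credit fraction never exceeds the interval fraction). [folklore] -/
theorem inside_of_credit (h : credit lo hi Tc τ = true) : inside lo hi Tc τ = true := (credit_eq_true_iff.mp h).1

/-- An `uninformative` band earns no credit, inside or not («printed INSIDE, credited nothing»). [folklore] -/
theorem credit_eq_false_of_uninformative (h : infoClass lo hi = .uninformative) : credit lo hi Tc τ = false := by
  simp [credit, h]

/-- An inside band of span ≤ 10 K is credited (weak-coupling bands: Al, Pb ambient). [folklore] -/
theorem credit_of_inside_of_span_le (hin : inside lo hi Tc τ = true) (h : hi - lo ≤ 10) : credit lo hi Tc τ = true :=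
  credit_eq_true_iff.mpr ⟨hin, infoClass_ne_uninformative_of_span_le h⟩

/-- An inside band with w ≤ 4 is credited. [folklore] -/
theorem credit_of_inside_of_le_four_mul (hin : inside lo hi Tc τ = true) (h : hi ≤ 4 * lo) :
    credit lo hi Tc τ = true :=
  credit_eq_true_iff.mpr ⟨hin, infoClass_ne_uninformative_of_le_four_mul h⟩

/-- THE SAYS-NOTHING THEOREM, part 1: a band `[0, B]` is INSIDE for EVERY measured `Tc ≤ B + τ` (τ ≥ 0, Tc ≥ 0)
— «a [0, 300] K band «hits» everything». [folklore] -/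
theorem inside_zero_lo {B : ℚ} (hτ : 0 ≤ τ) (hTc : 0 ≤ Tc) (h : Tc ≤ B + τ) : inside 0 B Tc τ = true :=
  inside_iff.mpr ⟨by linarith, h⟩

/-- THE SAYS-NOTHING THEOREM, part 2: once `B > 10 K` the band `[0, B]` is `uninformative` … [folklore] -/
theorem infoClass_zero_lo {B : ℚ} (hB : 10 < B) : infoClass 0 B = .uninformative :=
  (infoClass_eq_uninformative_iff le_rfl (by linarith)).mpr ⟨by linarith, by linarith⟩

/-- … «and says nothing»: it earns no credit whatever the truth. [folklore] -/
theorem credit_zero_lo_eq_false {B : ℚ} (hB : 10 < B) : credit 0 B Tc τ = false :=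
  credit_eq_false_of_uninformative (infoClass_zero_lo hB)

end creditRule

/-! ## §2 Bands on a measured-normal column: FALSE / STRADDLE / OK (ACCEPTANCE §4.4, v1.3) -/

/-- §4.4 «FALSE-BAND if lo > T_min_measured (oracle predicts SC where none is seen)». [folklore] -/
def falseBand (lo Tmin : ℚ) : Bool := decide (Tmin < lo)

/-- §4.4 v1.3 «STRADDLE BAND: lo ≤ T_min_measured ≤ hi (and hi ≥ 0.1 K)». [folklore] -/
def straddleBand (lo hi Tmin : ℚ) : Bool := decide (lo ≤ Tmin) && decide (Tmin ≤ hi) && decide ((1 : ℚ) / 10 ≤ hi)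

section noSC

variable {lo hi Tmin : ℚ}

/-- `straddleBand` unfolded. [folklore] -/
theorem straddleBand_iff : straddleBand lo hi Tmin = true ↔ lo ≤ Tmin ∧ Tmin ≤ hi ∧ (1 : ℚ) / 10 ≤ hi := by
  simp [straddleBand, and_assoc]

/-- FALSE and STRADDLE exclude each other. [folklore] -/
theorem not_false_and_straddle : ¬ (falseBand lo Tmin = true ∧ straddleBand lo hi Tmin = true) := by
  rintro ⟨hf, hs⟩
  simp only [falseBand, decide_eq_true_eq] at hf
  linarith [(straddleBand_iff.mp hs).1]

/-- TRICHOTOMY for an ASSERTING band (hi ≥ 0.1 K): one of FALSE (lo > T_min), STRADDLE, OK (hi < T_min) holds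
(exactly one when lo ≤ hi, by the two exclusion lemmas). [folklore] -/
theorem false_or_straddle_or_ok (hhi : (1 : ℚ) / 10 ≤ hi) :
    falseBand lo Tmin = true ∨ straddleBand lo hi Tmin = true ∨ hi < Tmin := by
  by_cases h1 : Tmin < lo
  · exact Or.inl (by simp [falseBand, h1])
  · by_cases h2 : Tmin ≤ hi
    · exact Or.inr (Or.inl (straddleBand_iff.mpr ⟨not_lt.mp h1, h2, hhi⟩))
    · exact Or.inr (Or.inr (not_le.mp h2))

/-- OK excludes the other two. [folklore] -/
theorem not_false_not_straddle_of_ok (hle : lo ≤ hi) (h : hi < Tmin) :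
    falseBand lo Tmin = false ∧ straddleBand lo hi Tmin = false := by
  constructor
  · simp only [falseBand, decide_eq_false_iff_not, not_lt]
    linarith
  · rw [Bool.eq_false_iff, Ne, straddleBand_iff]
    rintro ⟨_, h2, _⟩
    linarith

variable {Tfloor : ℚ} {cells : List (ℚ × Word)} {bands : List (ℚ × ℚ)}

/-- «its material verdict can never be NOT (band hi ≥ 0.1 K)»: a map carrying a straddle band is never verdict
NOT (§4.5 `verdict`). [folklore] -/
theorem verdict_ne_NOT_of_straddle (hmem : (lo, hi) ∈ bands) (hs : straddleBand lo hi Tmin = true) :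
    verdict Tfloor cells bands ≠ .NOT := by
  obtain ⟨-, -, hhi⟩ := straddleBand_iff.mp hs
  unfold verdict
  split_ifs with h1 h2
  · simp
  · simp only [saysNOT, Bool.and_eq_true, Bool.not_eq_true', List.any_eq_false, decide_eq_true_eq] at h2
    exact absurd hhi (h2.2 (lo, hi) hmem)
  · simp

/-- «it is UNDETERMINED (ABSTAIN …) or … FP»: on a non-superconductor (truth class NOT) a map with a straddle
band scores ABSTAIN or FP — never TN, never FN. [folklore] -/
theorem kind_of_straddle (hmem : (lo, hi) ∈ bands) (hs : straddleBand lo hi Tmin = true) :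
    kind (verdict Tfloor cells bands) false = .ABSTAIN ∨ kind (verdict Tfloor cells bands) false = .FP := by
  have h := verdict_ne_NOT_of_straddle (Tfloor := Tfloor) (cells := cells) hmem hs
  revert h
  cases verdict Tfloor cells bands <;> simp [kind]

/-- A FALSE band on a column measured down to `T_min ≥ 0.1 K` has lo ≥ 0.1 K, hence verdict SC … [folklore] -/
theorem verdict_eq_SC_of_falseBand (hT : (1 : ℚ) / 10 ≤ Tmin) (hf : falseBand lo Tmin = true)
    (hmem : (lo, hi) ∈ bands) : verdict Tfloor cells bands = .SC := by
  simp only [falseBand, decide_eq_true_eq] at hf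
  rw [verdict_eq_SC_iff, saysSC_eq_true_iff]
  exact Or.inr ⟨(lo, hi), hmem, by simp; linarith⟩

/-- … i.e. an FP on a non-superconductor — «caught by differentiation and PASS-TV3». [folklore] -/
theorem kind_eq_FP_of_falseBand (hT : (1 : ℚ) / 10 ≤ Tmin) (hf : falseBand lo Tmin = true)
    (hmem : (lo, hi) ∈ bands) : kind (verdict Tfloor cells bands) false = .FP := by
  rw [verdict_eq_SC_of_falseBand (Tfloor := Tfloor) (cells := cells) hT hf hmem]
  rfl

/-- LEVEL-2 CONTRAST: a straddle band forces NO cell disagreement — W3 permits the word «not» at every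
`T ≥ T_min` (because `lo ≤ T_min ≤ T`), and that word AGREES with the measured-normal truth there; below `T_min`
the truth is unknown. (A FALSE band instead forces disagreements on `[T_min, lo)`:
`disagree_or_undetermined_of_falseBand`.) So the straddle is visible only at level 4. [folklore] -/
theorem straddle_allows_agreeing_not {T : ℚ} (hs : straddleBand lo hi Tmin = true) (hT : Tmin ≤ T) :
    w3Cell lo hi T .not = true ∧ outcome .not (truthNoSC Tmin T) = .agree := by
  obtain ⟨h1, -, -⟩ := straddleBand_iff.mp hs
  refine ⟨w3Cell_iff.mpr ⟨fun h => absurd h (not_lt.mpr (h1.trans hT)), fun _ => by simp⟩, ?_⟩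
  rw [truthNoSC_of_le hT]
  rfl

end noSC

/-! ## §3 The §4.4 BECAUSE-line numbers, evaluated -/

section cases

/-- H₃S-type [120, 290] K: r = 170/410 ≈ 0.41 ⇒ `moderate` (credited when inside). [folklore] -/
example : infoClass 120 290 = .moderate := by norm_num [infoClass, relHalfWidth]
/-- [50, 290] K: w = 5.8, span 240 K ⇒ `uninformative` (inside for T_c = 203 ± 8 K, yet no credit). [folklore] -/
example : infoClass 50 290 = .uninformative ∧ inside 50 290 203 (203 / 20) = true ∧ credit 50 290 203 (203 / 20) = false := by
  norm_num [credit, infoClass, relHalfWidth, inside, InfoClass.informative_ne_uninformative,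
    InfoClass.moderate_ne_uninformative, InfoClass.wideShortSpan_ne_uninformative]
/-- MgB₂'s pre-stated boxed band [13, 79] K: w ≈ 6.1, span 66 K ⇒ `uninformative`: «inside, uninformative, no
credit» against 39 ± 1 K (τ = 1.95). [folklore] -/
example : infoClass 13 79 = .uninformative ∧ inside 13 79 39 (39 / 20) = true ∧ credit 13 79 39 (39 / 20) = false := by
  norm_num [credit, infoClass, relHalfWidth, inside, InfoClass.informative_ne_uninformative,
    InfoClass.moderate_ne_uninformative, InfoClass.wideShortSpan_ne_uninformative]
/-- an informative MgB₂ band [33, 42] K (w 1.27): credited. [folklore] -/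
example : infoClass 33 42 = .informative ∧ credit 33 42 39 (39 / 20) = true := by
  norm_num [credit, infoClass, relHalfWidth, inside, InfoClass.informative_ne_uninformative,
    InfoClass.moderate_ne_uninformative, InfoClass.wideShortSpan_ne_uninformative]
/-- Al-type weak coupling [0.5, 2.3] K: w = 4.6 > 4 but span 1.8 K ≤ 10 K ⇒ `wide(span≤10K)`, credited against
1.18 ± 0.05 K (τ = 1 K). [folklore] -/
example : infoClass (1 / 2) (23 / 10) = .wideShortSpan ∧ credit (1 / 2) (23 / 10) (118 / 100) 1 = true := by
  norm_num [credit, infoClass, relHalfWidth, inside, InfoClass.informative_ne_uninformative,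
    InfoClass.moderate_ne_uninformative, InfoClass.wideShortSpan_ne_uninformative]
/-- the 10 K guard is an absolute scale: [2, 9] K (w 4.5) is `wide(span≤10K)`; [20, 90] K, same r, is
`uninformative`. [folklore] -/
example : relHalfWidth 2 9 = relHalfWidth 20 90 ∧ infoClass 2 9 = .wideShortSpan ∧ infoClass 20 90 = .uninformative := by
  norm_num [infoClass, relHalfWidth]
/-- Cu (T_min = 10 μK ≈ 1/100000 K), straddle band [0, 5] K (score.py selftest S6): STRADDLE, not FALSE; with
«not» cells above T_min and no SC cell the verdict is UNDETERMINED ⇒ ABSTAIN (never TN). [folklore] -/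
example : straddleBand 0 5 (1 / 100000) = true ∧ falseBand 0 (1 / 100000) = false := by
  norm_num [straddleBand, falseBand]
example : verdict (1 / 100000) [(0, Word.undetermined), (4, Word.not), (300, Word.not)] [(0, 5)] = .UNDETERMINED := by
  norm_num [verdict, saysSC, saysNOT, relevant, Word.undetermined_ne_SC, Word.not_ne_SC, Word.undetermined_ne_not]
/-- a FALSE band [8, 14] K on La₂CuO₄ (T_min = 4.2 K): verdict SC ⇒ FP. [folklore] -/
example : falseBand 8 (42 / 10) = true ∧
    kind (verdict (42 / 10) [(0, Word.SC), (6, Word.SC), (20, Word.not)] [(8, 14)]) false = .FP := by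
  norm_num [falseBand, verdict, saysSC, kind]

end cases

end CellScore

end Summit.Ventures.CertifiedManyBodySolver.Downfold
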